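import Literature.Barriers.ValiantsHypothesis.ShiftedPartialDerivatives
import Literature.Barriers.ValiantsHypothesis.UnpaddedShiftedPartialsProofs
import Literature.Barriers.ValiantsHypothesis.UnpaddedShiftedPartialsPowerSum
import Literature.Computability.AlgebraicComplexity.StandardFamilies
import HarnessLib

/-!
# Barrier catalogue `ValiantsHypothesis`: shifted partial derivatives cannot separate the
permanent from iterated matrix multiplication WITHOUT padding (Gesmundo–Landsberg 2019)

D-0021 barrier entry for the summit `ValiantsHypothesis` (`VP ≠ VNP`; here in Nisan's padding-free
`VP_s`-complete model). It complements the tree's padded entry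
`Literature/Barriers/ValiantsHypothesis/ShiftedPartialDerivatives.lean`
(`ShiftedPartialsCannotSeparate`, Efremenko–Landsberg–Schenck–Weyman: `ℓ^{n-m} perm_m` versus
`det_n`, `n > 2m² + 2m`), answering Mulmuley's question whether that no-go survives in a model
without padding: it does, with `IMM^m_n` in place of `det_n` and threshold `n > m⁵`.

**The printed statements** (`lit read arxiv:1705.03866`; Gesmundo–Landsberg, *Explicit polynomial
sequences with maximal spaces of partial derivatives and a question of K. Mulmuley*, Theory of
Computing 15 (2019), art. 3; numbering of the arXiv version).

* Abstract: "In [ELSW] it was shown that the method of shifted partial derivatives cannot be used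
  to separate the padded permanent from the determinant. Mulmuley asked if this no-go result could
  be extended to a model without padding. We prove this is indeed the case using the iterated
  matrix multiplication polynomial."
* §1, the method: "`p_{(e,d-e)[τ]} : S^eℂ^{N*} ⊗ S^τℂ^N → S^{d-e+τ}ℂ^N`, `D ⊗ q ↦ qD(p)` ... Let
  `⟨∂^{=e}p⟩_{=τ} := p_{(e,d-e)[τ]}(S^eℂ^{N*} ⊗ S^τℂ^N)`. Again, semi-continuity of matrix rank
  guarantees that if `p` is a degeneration of `q`, then `dim⟨∂^{=e}q⟩_{=τ} ≥ dim⟨∂^{=e}p⟩_{=τ}`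
  for all `τ` and the method of shifted partials can be used to prove that `p` is not a
  degeneration of `q` by showing that `dim⟨∂^{=e}p⟩_{=τ} > dim⟨∂^{=e}q⟩_{=τ}` for some `τ`."
* §1, Definition 1: "`IMM^d_n : (X_1, …, X_d) ↦ trace(X_1 ⋯ X_d)`" (`n × n` matrices of
  indeterminates) — the tree's `immPoly n d ℂ`.
* §1, the model: "By [Nisan 1991], the polynomials `IMM^d_n` and `Pow^d_n` can be used to define
  `VP_s`-complete sequences without the use of padding. More precisely, a sequence of homogeneous
  polynomials `{f_m}` ... is in `VP_s` if and only if there exists a function `n(m)` ... growing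
  polynomially in `m`, such that `f_m` is a specialization of `IMM^{d_m}_{n(m)}` ... In particular,
  Valiant's `VP_s ≠ VNP` conjecture can be rephrased by stating that there is no polynomially
  bounded function `n(m)` such that the permanent polynomial `perm_m` is a specialization of
  `IMM^m_{n(m)}` (or of `Pow^m_{n(m)}`)."
* **Theorem 2**: "If `n > m⁵`, then `perm_m` cannot be separated from `IMM^m_n` by the method of
  shifted partial derivatives. More precisely, given any linear inclusion `ℂ^{m²} ⊆ ℂ^{mn²}`
  considering `perm_m ∈ S^mℂ^{mn²}` as a polynomial that just involves `m²` of the `mn²`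
  variables, then for all choices of `e`, `τ`,
  `dim⟨∂^{=e}(perm_m ∈ S^mℂ^{mn²})⟩_{=τ} ≤ dim⟨∂^{=e} IMM^m_n⟩_{=τ}`."

**Rendering.** `dim⟨∂^{=e}p⟩_{=τ}` is the tree's `shiftedPartialsRank ℂ e τ p` (ELSW's
`rank(P_{(k,n-k)[τ]})`, same map); `IMM^m_n` is `immPoly n m ℂ` (variables
`Fin m × Fin n × Fin n`); "`perm_m` as a polynomial that just involves `m²` of the `mn²`
variables" is `rename ι (perPoly (Fin m) ℂ)` for an injective relabelling
`ι : Fin m × Fin m → Fin m × Fin n × Fin n` (the coordinate inclusions; a general linear inclusion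
differs from one of these by an element of `GL_{mn²}`, under which all the dimensions are
invariant — only the coordinate form is vendored). "Separated by the method" is the tree's
`ShiftedPartialsSeparate` (strict inequality at some order `0 < k < deg` and shift `τ`). Theorem 2
as printed (all `e, τ`) is a NAMED FACT; the no-separation consequences are proved from it.

**What the printed proof (§4) establishes, and what the tree proves** (appended 2026-08-15 by the
literature-prover holding this fact; checked against the arXiv text, p. 9 of the held copy). The
proof has three cases. Case 1 (`s ≥ ⌈m/2⌉`, all `τ`: degenerate `IMM^m_n` to `q_nᵏ` / `ℓ q_nᵏ`, whose
order-`s` flattening is surjective by Reznick's theorem = GL Thm. 4 / GL Thm. 7) and Case 2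
(`s < ⌈m/2⌉`: injective flattening, Macaulay's bound, and the estimate "`(n+τ)/(τ+s) > m²`, which
holds when `n ≥ m⁵` and `τ ≤ 2m³`") are sound, except that with `n = m⁵ + 1`, `s = 1`, `τ = 2m³ - 1`
the displayed quotient is `(m⁵ + 2m³)/(2m³) ≈ m²/2`, so the displayed sufficient condition yields
`τ ≤ m³`, not `τ < 2m³`. THIS RANGE IS PROVED IN THE TREE, unconditionally and without Macaulay's
theorem (for `qᵏ` the shifted-partials dimension is explicit):
`GesmundoLandsberg2017_thm2_printedRange_holds` (this file) =
`gesmundoLandsberg_thm2_printedRange` (`UnpaddedShiftedPartialsProofs.lean`): for `n > m⁵`, every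
injective `ι`, and all `(e, τ)` with `⌈m/2⌉ ≤ e ∨ τ ≤ m³`, `rank(perm side) ≤ rank(IMM side)`.
Case 3 (`s < m/2`, `τ > m³`) degenerates `IMM^m_n` to the power sum `P = y_1^m + ⋯ + y_{m²}^m` ("set
all matrices equal to a matrix that is zero except for the first `m²` entries on the diagonal") and
asserts "it will suffice to prove the result for the shifted partials of both polynomials in `m²`
variables because the remaining `mn² - m²` variables will contribute the same growth to both ideals",
then checks surjectivity in `m²` variables for shifts `> m³` only. But for a polynomial `p` in a subset
`V₁` of the variables `V`, `dim⟨∂^{=s}p⟩^V_τ = Σ_{j ≤ τ} dim⟨∂^{=s}p⟩^{V₁}_j · #Mon_{τ-j}(V ∖ V₁)` mixes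
ALL shifts `j ≤ τ`, and at small shifts `P` loses: every order-`s` derivative of `P` is a scalar
multiple of some `y_i^{m-s}`, so `dim⟨∂^{=s}P⟩^V_τ ≤ m² · binom(N+τ-1, τ)` (`N = mn²`; tree:
`shiftedPartialsRank_powerSum_le`), whereas the `binom(m,s)²` independent order-`s` derivatives of
the permanent multiplied by the monomials of degree `τ` in the `N - m²` variables outside the
permanent's stay independent, so `dim⟨∂^{=s}perm_m⟩^V_τ ≥ binom(m,s)² · binom(N-m²+τ-1, τ)` (tree:
`card_mul_shiftedPartialsRank_zero_le`, `choose_sq_mul_choose_le_shiftedPartialsRank_perm`); since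
`binom(N+τ-1,τ)/binom(N-m²+τ-1,τ) ≤ (1 + τ/(N-m²))^{m²}`, the displayed degeneration has strictly
FEWER shifted partials than the permanent whenever `2 ≤ s ≤ m - 2` and
`m³ < τ < (N - m²) ln(binom(m,s)²/m²)/m²` (e.g. `m = 6, s = 2, n = 7777`: all `217 ≤ τ ≤ 10⁷`), a range
in which Case 2's comparison `binom(n+s+τ-1,s+τ) > binom(m,s)² binom(n+τ-1,τ)` also fails (in the
example from `τ = 554` on; its displayed sufficient form `(n+τ)/(τ+s) > m²` from `τ = 221` on) — in
the tree: `exists_case3_degeneration_lt` (`UnpaddedShiftedPartialsPowerSum.lean`: under that numerical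
condition the printed degeneration is an element of `End · IMM^m_n` with strictly fewer shifted
partials than the permanent). No other argument is printed for
`2 ≤ s < ⌈m/2⌉, τ > m³` (for `s = 1` the printed justification is likewise incomplete), and no erratum
is known to us; the asymptotic truth of the inequality for `τ → ∞` is plausible (Krull dimension of
the Jacobian loci) but unproved here. Accordingly the full Theorem 2 stays a named fact, its
established part is the def `GesmundoLandsberg2017_thm2_printedRange` (proved), and the no-separation
corollaries are given in both forms.
-/

noncomputable section

namespace Literature.Barriers.ValiantsHypothesis

open Literature.Computability.AlgebraicComplexity MvPolynomial

/-- **Gesmundo–Landsberg, Thm. 2** (named fact): for `n > m⁵`, every coordinate copy of `perm_m`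
inside the `mn²` variables of `IMM^m_n` has ALL shifted-partials dimensions bounded by those of
`IMM^m_n`: `dim⟨∂^{=e} perm_m⟩_{=τ} ≤ dim⟨∂^{=e} IMM^m_n⟩_{=τ}` for all `e, τ`.
[cite: GesmundoLandsberg2017, Thm. 2] -/
def GesmundoLandsberg2017_thm2 : Prop :=
  ∀ m n : ℕ, m ^ 5 < n → ∀ ι : Fin m × Fin m → Fin m × Fin n × Fin n, Function.Injective ι →
    ∀ e τ : ℕ, shiftedPartialsRank ℂ e τ (rename ι (perPoly (Fin m) ℂ)) ≤
      shiftedPartialsRank ℂ e τ (immPoly n m ℂ)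

/-- BARRIER: **no shifted-partials separation of `perm_m` from `IMM^m_n` for `n > m⁵`**
(Gesmundo–Landsberg 2019, Thm. 2; the padding-free companion of `ShiftedPartialsCannotSeparate`).
technique_class: shifted-partial-derivatives, partial-derivatives-method, flattening-rank, Jacobian-ideal-Hilbert-function, rank-semicontinuity, degeneration-obstructions, unpadded-model, IMM-model (`ShiftedPartialsSeparate m P Q` with `Q = immPoly n m ℂ`) [cite: GesmundoLandsberg2017, §1]
blocks: proving by the method of shifted partial derivatives that `perm_m` is not a degeneration (a fortiori not a specialization) of `IMM^m_n` for any `n > m⁵` (`UnpaddedShiftedPartials.not_separate`), hence any super-polynomial — indeed any better than `n(m) ≤ m⁵` — lower bound in Nisan's padding-free `VP_s`-complete model, in which "Valiant's `VP_s ≠ VNP` conjecture can be rephrased by stating that there is no polynomially bounded function `n(m)` such that ... `perm_m` is a specialization of `IMM^m_{n(m)}`" (`ValiantsHypothesis` in the `VP_s`/`VBP` form; tree: `Literature.Computability.AlgebraicComplexity.DcPerSuperpolynomial`, route `ValiantsHypothesis/DetQP`) [cite: GesmundoLandsberg2017, Thm. 2 and §1].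
because: for `n > m⁵` and every `e, τ` the dimension `dim⟨∂^{=e} perm_m⟩_{=τ}` (permanent placed on `m²` of the `mn²` variables) is at most `dim⟨∂^{=e} IMM^m_n⟩_{=τ}` (`GesmundoLandsberg2017_thm2`), while the method separates only through a strict inequality the other way, degenerations being unable to increase these dimensions by semicontinuity of rank [cite: GesmundoLandsberg2017, Thm. 2 and §1]; the padded analogue for `det_n` is ELSW's theorem [cite: EfremenkoLandsbergSchenckWeyman2018, Thm. 1.5].
evasions_known: none published for this pair; in general, finer invariants of the flattening maps than their ranks — Koszul and Young flattenings ("first explicit sequence of polynomials with symmetric border rank lower bounds higher than the bounds attainable via partial derivatives") [cite: GesmundoLandsberg2017, abstract and §1 (Additional results)], and for the padded determinant model minimal free resolutions / more general Young flattenings are suggested [cite: EfremenkoLandsbergSchenckWeyman2018, §1.2 and Rem. 1.4].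
scope_caveats: printed for the pair (`perm_m`, `IMM^m_n`) with `n > m⁵` only — nothing is claimed for `n ≤ m⁵` (so polynomial separations up to `m⁵` are not excluded), for the power-sum model `Pow^m_n` (a specialization of `IMM^m_n`, for which the inequality is not asserted), or for the determinant without padding; "any linear inclusion" is vendored only for coordinate inclusions `rename ι` (general ones differ by `GL_{mn²}`, which preserves the dimensions, but that invariance is not in the tree); nothing is printed about sharpness of the threshold `m⁵`; MOREOVER the printed proof (§4) establishes the inequality only for `⌈m/2⌉ ≤ e` (Case 1) or `τ ≤ m³` (Case 2, whose closing estimate `(n+τ)/(τ+s) > m²` gives `τ ≤ m³` at `n = m⁵+1`, not the printed `τ < 2m³`) — that range is PROVED in the tree (`GesmundoLandsberg2017_thm2_printedRange_holds`) — while its Case 3 (`e < m/2`, `τ > m³`, degeneration to `y_1^m + ⋯ + y_{m²}^m` compared "in `m²` variables") does not establish the remaining range: padding to `mn²` variables mixes all shifts `≤ τ`, and the displayed degeneration has at most `m²·binom(N+τ-1,τ)` shifted partials against at least `binom(m,e)²·binom(N-m²+τ-1,τ)` for the permanent, fewer for `2 ≤ e ≤ m-2`, `m³ < τ ≲ N/m²`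 (module docstring; tree: `exists_case3_degeneration_lt`) [cite: GesmundoLandsberg2017, §4 (Cases 1–3)].
status: theorem as printed [cite: GesmundoLandsberg2017, Thm. 2]; established (and proved here) in the range `⌈m/2⌉ ≤ e ∨ τ ≤ m³`; for `e < ⌈m/2⌉, τ > m³` the printed argument is incomplete (scope_caveats; no published erratum or dissent known) and the statement is vendored unverified as the named fact `GesmundoLandsberg2017_thm2` [cite: GesmundoLandsberg2017, Thm. 2 and §4] -/
def UnpaddedShiftedPartials : Prop := GesmundoLandsberg2017_thm2

/-- The barrier is (definitionally) Theorem 2. [cite: GesmundoLandsberg2017, Thm. 2] -/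
theorem unpaddedShiftedPartials_iff : UnpaddedShiftedPartials ↔ GesmundoLandsberg2017_thm2 :=
  Iff.rfl

/-- **No separation**: for `n > m⁵` the method of shifted partial derivatives (tree class
`ShiftedPartialsSeparate`, degree `m`) does not separate any coordinate copy of `perm_m` from
`IMM^m_n`. [cite: GesmundoLandsberg2017, Thm. 2] -/
theorem UnpaddedShiftedPartials.not_separate (h : UnpaddedShiftedPartials) {m n : ℕ}
    (hn : m ^ 5 < n) (ι : Fin m × Fin m → Fin m × Fin n × Fin n) (hι : Function.Injective ι) :
    ¬ ShiftedPartialsSeparate m (rename ι (perPoly (Fin m) ℂ)) (immPoly n m ℂ) := by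
  rintro ⟨k, τ, -, -, hlt⟩
  exact absurd hlt (not_lt.2 (h m n hn ι hι k τ))

/-- **No lower bound beyond `m⁵` in the `IMM` model**: for every size function `N` with
`N m > m⁵` for all `m` (e.g. `N m = m⁵ + 1`, or any larger, possibly super-polynomial `N`), the
method never separates `perm_m` from `IMM^m_{N m}` — so it cannot show that `perm_m` fails to be a
specialization of `IMM^m_{N(m)}`, which for polynomially bounded `N` is what `VP_s ≠ VNP` requires.
[cite: GesmundoLandsberg2017, Thm. 2 and §1] -/
theorem UnpaddedShiftedPartials.not_separate_of_lt (h : UnpaddedShiftedPartials) (N : ℕ → ℕ)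
    (hN : ∀ m, m ^ 5 < N m) (m : ℕ) (ι : Fin m × Fin m → Fin m × Fin (N m) × Fin (N m))
    (hι : Function.Injective ι) :
    ¬ ShiftedPartialsSeparate m (rename ι (perPoly (Fin m) ℂ)) (immPoly (N m) m ℂ) :=
  h.not_separate (hN m) ι hι

/-- Non-vacuity of the quantifier over inclusions: for `1 ≤ n` (in particular `n > m⁵ ≥ 0` with
`m ≥ 1`, or any `n ≥ 1`) there is an injective coordinate inclusion of the `m²` permanent variables
into the `mn²` variables of `IMM^m_n`, e.g. `(i, j) ↦ (i, j', 0)` with `j'` the image of `j` under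
`Fin m ↪ Fin n` when `m ≤ n`. Here the simplest instance `m ≤ n`. [folklore] -/
theorem exists_injective_inclusion {m n : ℕ} (hmn : m ≤ n) (hn : 1 ≤ n) :
    ∃ ι : Fin m × Fin m → Fin m × Fin n × Fin n, Function.Injective ι := by
  refine ⟨fun ij => (ij.1, Fin.castLE hmn ij.2, ⟨0, hn⟩), ?_⟩
  rintro ⟨i, j⟩ ⟨i', j'⟩ h
  simp only [Prod.mk.injEq] at h
  obtain ⟨rfl, hj, -⟩ := h
  have := Fin.castLE_injective hmn hj
  subst this
  rfl

/-! ### The range established by the printed proof (appended; D-0014 append protocol) -/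

/-- **Gesmundo–Landsberg, Thm. 2 — the part its printed proof establishes** (corrected statement of
the named fact `GesmundoLandsberg2017_thm2`, same cite): for `n > m⁵`, every coordinate copy of `perm_m`
inside the `mn²` variables of `IMM^m_n`, and all orders `e` and shifts `τ` with `⌈m/2⌉ ≤ e` (printed
Case 1) or `τ ≤ m³` (printed Case 2; the printed range "`τ < 2m³`" is what the text says, `τ ≤ m³` is
what its estimate `(n+τ)/(τ+s) > m²` gives at `n = m⁵ + 1`):
`dim⟨∂^{=e} perm_m⟩_{=τ} ≤ dim⟨∂^{=e} IMM^m_n⟩_{=τ}`. DISCREPANCY with the printed Theorem 2: the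
printed statement has no restriction on `(e, τ)`; the range `e < ⌈m/2⌉, τ > m³` rests on the printed
Case 3, which does not establish it (module docstring: the power-sum degeneration used there has
fewer shifted partials than the permanent for `2 ≤ e ≤ m - 2`, `m³ < τ ≲ N/m²`). PROVED:
`GesmundoLandsberg2017_thm2_printedRange_holds`. [cite: GesmundoLandsberg2017, Thm. 2 and §4 (Cases 1–2)] -/
def GesmundoLandsberg2017_thm2_printedRange : Prop :=
  ∀ m n : ℕ, m ^ 5 < n → ∀ ι : Fin m × Fin m → Fin m × Fin n × Fin n, Function.Injective ι →
    ∀ e τ : ℕ, ((m + 1) / 2 ≤ e ∨ τ ≤ m ^ 3) →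
      shiftedPartialsRank ℂ e τ (rename ι (perPoly (Fin m) ℂ)) ≤
        shiftedPartialsRank ℂ e τ (immPoly n m ℂ)

/-- The printed Theorem 2 contains its established part. [cite: GesmundoLandsberg2017, Thm. 2] -/
theorem GesmundoLandsberg2017_thm2.printedRange (h : GesmundoLandsberg2017_thm2) :
    GesmundoLandsberg2017_thm2_printedRange :=
  fun m n hn ι hι e τ _ => h m n hn ι hι e τ

/-- **DISCHARGE of the established part**: `GesmundoLandsberg2017_thm2_printedRange` holds — Cases 1
and 2 of GL §4, proved in `UnpaddedShiftedPartialsProofs.lean` (coordinate degenerations of `IMM^m_n`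
to `qᵏ` / `y qᵏ`, Reznick's theorem = GL Thm. 4 proved in the tree, monotonicity of the ranks under
`End(W)` proved in the tree, explicit monomial counting; no Macaulay theorem needed).
[cite: GesmundoLandsberg2017, Thm. 2 and §4 (Cases 1–2)] -/
theorem GesmundoLandsberg2017_thm2_printedRange_holds : GesmundoLandsberg2017_thm2_printedRange :=
  gesmundoLandsberg_thm2_printedRange

/-- **No separation at orders `e ≥ ⌈m/2⌉` (PROVED)**: for `n > m⁵` no order `k` with `⌈m/2⌉ ≤ k` and no
shift `τ` give the method a strict inequality `rank(IMM side) < rank(perm side)` — in particular the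
classical choice `k ≈ deg/2` of the method is excluded unconditionally.
[cite: GesmundoLandsberg2017, Thm. 2 and §4 (Case 1)] -/
theorem not_separate_of_half_le {m n : ℕ} (hn : m ^ 5 < n) (ι : Fin m × Fin m → Fin m × Fin n × Fin n)
    (hι : Function.Injective ι) {k : ℕ} (hk : (m + 1) / 2 ≤ k) (τ : ℕ) :
    ¬ shiftedPartialsRank ℂ k τ (immPoly n m ℂ) < shiftedPartialsRank ℂ k τ (rename ι (perPoly (Fin m) ℂ)) :=
  not_lt.2 (GesmundoLandsberg2017_thm2_printedRange_holds m n hn ι hι k τ (Or.inl hk))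

/-- **No separation with shifts `τ ≤ m³` (PROVED)**: for `n > m⁵`, no order `k` and no shift `τ ≤ m³`
give the method a strict inequality; in particular the method of partial derivatives (`τ = 0`) never
separates `perm_m` from `IMM^m_n`, `n > m⁵`. [cite: GesmundoLandsberg2017, Thm. 2 and §4 (Case 2)] -/
theorem not_separate_of_shift_le {m n : ℕ} (hn : m ^ 5 < n) (ι : Fin m × Fin m → Fin m × Fin n × Fin n)
    (hι : Function.Injective ι) (k : ℕ) {τ : ℕ} (hτ : τ ≤ m ^ 3) :
    ¬ shiftedPartialsRank ℂ k τ (immPoly n m ℂ) < shiftedPartialsRank ℂ k τ (rename ι (perPoly (Fin m) ℂ)) :=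
  not_lt.2 (GesmundoLandsberg2017_thm2_printedRange_holds m n hn ι hι k τ (Or.inr hτ))

/-- Hence (PROVED) any separation `ShiftedPartialsSeparate m (perm side) (IMM side)` for `n > m⁵` would
have to use an order `k < ⌈m/2⌉` together with a shift `τ > m³` — exactly the range the printed proof
leaves open. [cite: GesmundoLandsberg2017, Thm. 2 and §4] -/
theorem separate_only_in_open_range {m n : ℕ} (hn : m ^ 5 < n)
    (ι : Fin m × Fin m → Fin m × Fin n × Fin n) (hι : Function.Injective ι)
    (h : ShiftedPartialsSeparate m (rename ι (perPoly (Fin m) ℂ)) (immPoly n m ℂ)) :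
    ∃ k τ : ℕ, 0 < k ∧ k < (m + 1) / 2 ∧ m ^ 3 < τ ∧
      shiftedPartialsRank ℂ k τ (immPoly n m ℂ) < shiftedPartialsRank ℂ k τ (rename ι (perPoly (Fin m) ℂ)) := by
  obtain ⟨k, τ, hk0, -, hlt⟩ := h
  refine ⟨k, τ, hk0, ?_, ?_, hlt⟩
  · by_contra hk
    exact not_separate_of_half_le hn ι hι (not_lt.1 hk) τ hlt
  · by_contra hτ
    exact not_separate_of_shift_le hn ι hι k (not_lt.1 hτ) hlt

end Literature.Barriers.ValiantsHypothesis
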